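import Mathlib
import Literature.AlgebraicGeometry.RelativeSpec.FiniteGroupQuotientGenericEtale
import Summits.ResolutionOfSingularities.ResolutionOfSingularities.Theorems.WildQuotientsWildQuotientResolutionJordanFourConeVertexContraction

/-!
# V4U piece 0, ring brick `H₀` (3a/3): small preliminaries for the assembly

(crux stmt-ResolutionOfSingularities-15640 `WildQuotients.WildQuotientResolution`, line `Sketch`,
sector `|G| = p`; programme V4U of `L/w45c/CHAIN.md` v7.5 §4, RULING v7.5 / CORRECTION
2026-08-27T06:30:44Z «H₀ (μ₃ ring brick) = res-type-087». [OURS · L1 W4.5c] — NOT a statement of any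
manuscript; replaces the role of no printed item. Prover res-type-087.)

* `JordanFour.act_restrict_ι_appLE` — `Opens` form of Literature `ActionOver.act_restrict_top_appLE`:
  the restricted action on `Γ(O, ⊤)` is pulling back along `g⁻¹` upstairs.
* `JordanFour.exists_eq_generator_zpow` — every element of `⟨σ⟩` is a power of the generator.
* `JordanFour.isPrime_span_X_three` — `(x_a, x_b, x_c) ⊆ k[x]` is prime.
* `JordanFour.q8_mem_span_X` — the chart quotients `q_j`, `j ≠ 0`, lie in `(x_a, x_b, x_c)`.
-/

-- single-problem summit: the doubled namespace component `ResolutionOfSingularities` is forced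
set_option linter.dupNamespace false

noncomputable section

open CategoryTheory AlgebraicGeometry TopologicalSpace MvPolynomial
open Literature.AlgebraicGeometry.Resolution Literature.AlgebraicGeometry.RelativeSpec

namespace Summit.ResolutionOfSingularities.ResolutionOfSingularities.Theorems.WildQuotientResolution.JordanFour

universe u

/-! ## Small generic pieces -/

/-- **Equivariance of `Γ(X, O) → Γ(O, ⊤)`**, `Opens` form of
`ActionOver.act_restrict_top_appLE`: the restricted action of `g` on `Γ(O, ⊤)` is pulling back along
`g⁻¹` upstairs. [folklore] -/
theorem act_restrict_ι_appLE {X Y : Scheme.{u}} {r : X ⟶ Y} {G : Type*} [Group G]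
    (ρ : ActionOver r G) (O : X.Opens) (hO : ∀ g : G, (ρ.aut g).hom ⁻¹ᵁ O = O)
    (hOaff : IsAffineHom (O.ι ≫ r)) (g : G) (t : Γ(X, O))
    (hle : (⊤ : (O : Scheme.{u}).Opens) ≤ O.ι ⁻¹ᵁ O) (hst : O ≤ (ρ.aut g⁻¹).hom ⁻¹ᵁ O) :
    (ρ.restrict O hO).act g ⊤ (O.ι.appLE O ⊤ hle t) =
      O.ι.appLE O ⊤ hle ((ρ.aut g⁻¹).hom.appLE O O hst t) :=
  ActionOver.act_restrict_top_appLE ρ ⟨O, hO, hOaff⟩ g t hle hst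

/-- In a cyclic group `⟨σ⟩` every element is an integer power of the generator (subtype form).
[folklore] -/
theorem exists_eq_generator_zpow {M : Type*} [Group M] (σ : M) (g : ↥(Subgroup.zpowers σ)) :
    ∃ z : ℤ, g = (⟨σ, Subgroup.mem_zpowers σ⟩ : ↥(Subgroup.zpowers σ)) ^ z := by
  obtain ⟨z, hz⟩ := Subgroup.mem_zpowers_iff.mp g.2
  exact ⟨z, Subtype.ext (by rw [Subgroup.coe_zpow]; exact hz.symm)⟩

section Chart0

variable (k : Type) [Field k] (n : ℕ) (a b c : Fin n)

/-- `(x_a, x_b, x_c) ⊆ k[x]` is a prime ideal (kernel of killing the three variables;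
`ConeVertex.isPrime_span_X_image_compl_range`, p503613). [folklore] -/
theorem isPrime_span_X_three :
    (Ideal.span ({X a, X b, X c} : Set (MvPolynomial (Fin n) k))).IsPrime := by
  have h := ConeVertex.isPrime_span_X_image_compl_range (R := k)
    (f := fun i : {i : Fin n // ¬(i = a ∨ i = b ∨ i = c)} => (i.1 : Fin n))
    (fun i j hij => Subtype.ext hij)
  have hc : (Set.range (fun i : {i : Fin n // ¬(i = a ∨ i = b ∨ i = c)} => (i.1 : Fin n)))ᶜ =
      ({a, b, c} : Set (Fin n)) := by
    ext i
    simp only [Set.mem_compl_iff, Set.mem_range, Subtype.exists, exists_prop, exists_eq_right,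
      not_not, Set.mem_insert_iff, Set.mem_singleton_iff]
  rw [hc, ← Third112.X_triple_eq_image] at h
  exact h

/-- The chart quotients `q_j` of record (`JordanFour.chart0_ringEquiv_adjoin`). -/
local notation3 "q8" => (![1, X a * X b ^ 2, X b * X c, X c ^ 3, X b ^ 3, X b ^ 2 * X c ^ 2,
  X b * X c ^ 4, X c ^ 6] : Fin 8 → MvPolynomial (Fin n) k)

/-- The chart quotients `q_j`, `j ≠ 0`, lie in `(x_a, x_b, x_c)`. [folklore] -/
theorem q8_mem_span_X (j : Fin 8) (hj : j ≠ 0) :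
    q8 j ∈ Ideal.span ({X a, X b, X c} : Set (MvPolynomial (Fin n) k)) := by
  set M : Ideal (MvPolynomial (Fin n) k) := Ideal.span {X a, X b, X c} with hM
  have hXa : (X a : MvPolynomial (Fin n) k) ∈ M := Ideal.subset_span (by simp)
  have hXb : (X b : MvPolynomial (Fin n) k) ∈ M := Ideal.subset_span (by simp)
  have hXc : (X c : MvPolynomial (Fin n) k) ∈ M := Ideal.subset_span (by simp)
  fin_cases j
  · exact absurd rfl hj
  · exact M.mul_mem_left _ (M.pow_mem_of_mem hXb 2 two_pos)
  · exact M.mul_mem_left _ hXc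
  · exact M.pow_mem_of_mem hXc 3 three_pos
  · exact M.pow_mem_of_mem hXb 3 three_pos
  · exact M.mul_mem_left _ (M.pow_mem_of_mem hXc 2 two_pos)
  · exact M.mul_mem_left _ (M.pow_mem_of_mem hXc 4 four_pos)
  · exact M.pow_mem_of_mem hXc 6 (by norm_num)

end Chart0

end Summit.ResolutionOfSingularities.ResolutionOfSingularities.Theorems.WildQuotientResolution.JordanFour

end
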